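/- Copyright: the b2b-balaban cell (near-miss cell 7), T⁴-continuum fan-out, NE7b crux team (2), leaf lineage
t4-ne7b-formalise-leaf-05 on the owner's INTERFACE REQUEST NE7b IR-41-7 (ii).  Released under the licence of the
surrounding project. -/
import Summits.QuantumFields.BalabanUV.T4Continuum.Support.HistoryGenealogyInstantiateMWF
import Summits.QuantumFields.BalabanUV.T4Continuum.Support.HistoryGenealogyInstantiateClauses
import Summits.QuantumFields.BalabanUV.T4Continuum.Support.HistoryGenealogyRealiseW

/-!
# INSTANTIATION FROM THE LEVEL SETS, MEMORY-GENERIC PROCESS, part 3 (IR-41-7 (ii), brick 4-M): the MEMORY-AGNOSTIC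
clauses `LevelClausesW` HOLD for the memory-generic construction `RunInputM.StM` under the domination `Rm t k ≤ R t`,
and EVERY COMPONENT'S PEDIGREE IS WEAKLY REALISED (`RealisesW`) — the M-twin of row S15's
`HistoryGenealogyInstantiateClauses` (INTERFACE REQUEST NE7b IR-41-7 (ii) of the row-NE7b OWNER t4-ne7b-p1 gen 41;
ruling R-OWNER-41-1, repair route R-41-a; filed by leaf lineage t4-ne7b-formalise-leaf-05 — PRE-POSITIONING ONLY)

Summits-side support leaf of the T⁴-continuum cell (rung (B)+1 on a FINITE torus only; NOT infinite volume, NOT the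
mass gap, NOT the Clay statement; NOT a proof of the spine estimate NE7b, which is the cell's OWN estimate, NOT PRINTED
and NOT PROVED).  [folklore] finite combinatorics over bricks 3-M∕3b-M (`RunInputM.StM`, `histM`, `rnwM`, `wf_histM`,
`StM_nonempty_disjoint`, `constit_lab_newLineM`, `enumBM_spec`, `mem_partsM_iff`), row S15 brick 4's generic shape
lemmas (`list_eq_singleton_of_nodup`, `two_le_length_of_mem_ne`, `lastStep_assembleR_of_two_le`,
`lonePartR_eq_none_of_two_le`, `RunInput.map_eq_singleton` — REUSED), row S13-R (`pgenR` one-step equations), IR-41-7 (i)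
`HistoryGenealogyRealiseW` (`LevelClausesW`, `realisesW_pgenR`, `disjoint_orbit_of_disjoint_domW`, `adm_of_mem_compW`),
IR-41-2 `HistoryRealiseMemory` (`StopsM`, `stopsM_of_stops`), the cores (`RealisesW`, `PendingBefore`, `Stops`); nothing
printed is asserted, no `def … : Prop` fact of Bałaban's, no cite-tagged hypothesis, zero `sorry`.  B16 =
[Balaban1989LargeFieldII] pp. 383–387, B15 = [Balaban1989LargeFieldI] pp. 177, 198: manuscripts UNDER AUDIT; locators
only (C-B16-6).

WHAT IS PROVED.  §1 shape lemmas for the M-process (`enumBM_singleton`, `constitM_block_inl`∕`_inr`,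
`two_le_length_constitM`, `blockM_of_constit_inl`∕`_inr`, **`rnwM_lab_iff`**, `mem_StM_of_inl_mem_blockM`).  §2
`event_caseM`, **THE INVARIANT `invM`**: for every line live at level `ℓ`, `t ≤ ℓ`, `(t, E) = ((pgenR ℓ (lab τ)).lastStep,
edomR ℓ (lab τ))`, and `∀ k < ℓ − t, ¬ StopsM L s Rm t E k` (a live line has not been `Rm`-ready since its last event).
§3 `not_stops_of_not_stopsM`, **`levelClausesW_histM (hN : I.NewOK) (hRm : ∀ t k, I.Rm t k ≤ I.R t) :
LevelClausesW I.histM I.rnwM domL I.L I.s I.R`** — (G-readyW): flagged ⇒ renewed ⇒ `RdyM`-ready ⇒ `t < j` (`StopsM.pos`)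
and condition (i) (`StopsM.condI`), no FROZEN stop before by the invariant + domination (`stopsM_of_stops`); (G-pendR):
unflagged old vertex ⇒ alive, unrenewed ⇒ `RdyM`-unready at its level and before ⇒ `PendingBefore … (j + 1)` by
domination; geometry verbatim.  §4 **`realisesW_histM`**: for every component `c` of level `ℓ`,
`RealisesW L s R (pgenR ℓ c) (edomR ℓ c)` and `c.2 = orbit …`; **`disjoint_orbits_histM`**; `adm_histM`.  PRINT'S PROCESS
= the instance `Rm t k := R (t + k)` with `R` non-increasing (domination displayed, B15 p. 177 ∕ B14 p. 245, T-class);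
the landed S15 = the instance `Rm t _ := R t` (domination by `le_rfl`).

HONEST.  Proves nothing of Bałaban's; that Bałaban's large-field regions ARE the output of `StM` for the run's (N, F, Rm)
is the residual reading for M2∕M4; NE7b NOT proved; spine 0∕9.  HONEST DEPENDENCY (cell): continuum YM on T⁴ ⇐
BetaPertH ∧ nine spine estimates (0/9 proved); BetaPertH ⇐ (D1) ∧ (D4) ∧ CAP+tail; G-an2-4 gates asym, D1 and NE2/3/4.
This file changes none of it. -/

open Finset
open Literature.MathematicalPhysics.QuantumFieldTheory.Balaban1983to89
open Literature.MathematicalPhysics.QuantumFieldTheory.Balaban1983to89.B13ScaleTransfer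
open Literature.MathematicalPhysics.QuantumFieldTheory.Balaban1983to89.B16SProfile
open Literature.MathematicalPhysics.QuantumFieldTheory.Balaban1983to89.B16StoppingRule
open Literature.MathematicalPhysics.QuantumFieldTheory.Balaban1983to89.B16MergeGeometry
open Summit.QuantumFields.BalabanUV.T4Continuum.HistoryAdmissible
open Summit.QuantumFields.BalabanUV.T4Continuum.HistoryRealise
open Summit.QuantumFields.BalabanUV.T4Continuum.HistoryRealisePrint
open Summit.QuantumFields.BalabanUV.T4Continuum.HistoryRealiseWeak
open Summit.QuantumFields.BalabanUV.T4Continuum.HistoryRealiseMemory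
open Summit.QuantumFields.BalabanUV.T4Continuum.HistoryGenealogyExtraction
open Summit.QuantumFields.BalabanUV.T4Continuum.HistoryGenealogyRealise
open Summit.QuantumFields.BalabanUV.T4Continuum.HistoryTouchComponents

namespace Summit.QuantumFields.BalabanUV.T4Continuum.HistoryGenealogyInstantiate

noncomputable section

open Classical

variable {d : ℕ}

namespace RunInputM

variable (I : RunInputM d)

/-! ## §1 Shape lemmas for the memory-generic process -/

/-- the enumeration of a one-vertex block [folklore] -/
theorem enumBM_singleton {ℓ : ℕ} {prev : Finset (Line d)} {T : Finset (Line d ⊕ Lab d)} (hT : T ∈ I.blocksM ℓ prev)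
    {v : Line d ⊕ Lab d} (hv : T = {v}) : I.enumBM ℓ prev T = [v] := by
  refine list_eq_singleton_of_nodup (I.enumBM_spec hT).1 fun x => ?_
  rw [(I.enumBM_spec hT).2.1 x, hv, Finset.mem_singleton]

/-- constituents of the component of a lone OLD line [folklore] -/
theorem constitM_block_inl (hN : I.NewOK) {ℓ : ℕ} {T : Finset (Line d ⊕ Lab d)} (hT : T ∈ I.blocksM ℓ (I.PrevM ℓ))
    {τ : Line d} (h : T = {Sum.inl τ}) : I.histM.constit ℓ (lab (I.newLineM ℓ T)) = [Sum.inl (lab τ)] := by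
  rw [I.constit_lab_newLineM hN hT, I.enumBM_singleton hT h]; rfl

/-- constituents of the component of a lone NEW region [folklore] -/
theorem constitM_block_inr (hN : I.NewOK) {ℓ : ℕ} {T : Finset (Line d ⊕ Lab d)} (hT : T ∈ I.blocksM ℓ (I.PrevM ℓ))
    {n : Lab d} (h : T = {Sum.inr n}) : I.histM.constit ℓ (lab (I.newLineM ℓ T)) = [Sum.inr n] := by
  rw [I.constit_lab_newLineM hN hT, I.enumBM_singleton hT h]; rfl

/-- a block with two distinct vertices gives a constituent list of length `≥ 2` [folklore] -/
theorem two_le_length_constitM (hN : I.NewOK) {ℓ : ℕ} {T : Finset (Line d ⊕ Lab d)} (hT : T ∈ I.blocksM ℓ (I.PrevM ℓ))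
    {v w : Line d ⊕ Lab d} (hv : v ∈ T) (hw : w ∈ T) (hne : v ≠ w) :
    2 ≤ (I.histM.constit ℓ (lab (I.newLineM ℓ T))).length := by
  rw [I.constit_lab_newLineM hN hT, List.length_map]
  exact two_le_length_of_mem_ne (((I.enumBM_spec hT).2.1 v).2 hv) (((I.enumBM_spec hT).2.1 w).2 hw) hne

/-- a constituent list `[inl p]` comes from a lone old line labelled `p` [folklore] -/
theorem blockM_of_constit_inl (hN : I.NewOK) {ℓ : ℕ} {T : Finset (Line d ⊕ Lab d)} (hT : T ∈ I.blocksM ℓ (I.PrevM ℓ))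
    {p : Lab d} (h : I.histM.constit ℓ (lab (I.newLineM ℓ T)) = [Sum.inl p]) : ∃ τ, T = {Sum.inl τ} ∧ lab τ = p := by
  rw [I.constit_lab_newLineM hN hT] at h
  obtain ⟨x, hx, hfx⟩ := RunInput.map_eq_singleton h
  cases x with
  | inr n => simp [toLab] at hfx
  | inl τ =>
      refine ⟨τ, ?_, by simpa [toLab] using hfx⟩
      refine Finset.eq_singleton_iff_unique_mem.2 ⟨((I.enumBM_spec hT).2.1 _).1 (by rw [hx]; simp), fun y hy => ?_⟩
      have := ((I.enumBM_spec hT).2.1 y).2 hy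
      rw [hx] at this
      simpa using this

/-- a constituent list `[inr n]` comes from a lone new region `n` [folklore] -/
theorem blockM_of_constit_inr (hN : I.NewOK) {ℓ : ℕ} {T : Finset (Line d ⊕ Lab d)} (hT : T ∈ I.blocksM ℓ (I.PrevM ℓ))
    {n : Lab d} (h : I.histM.constit ℓ (lab (I.newLineM ℓ T)) = [Sum.inr n]) : T = {Sum.inr n} := by
  rw [I.constit_lab_newLineM hN hT] at h
  obtain ⟨x, hx, hfx⟩ := RunInput.map_eq_singleton h
  cases x with
  | inl τ => simp [toLab] at hfx
  | inr m =>
      have hmn : m = n := by simpa [toLab] using hfx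
      subst hmn
      refine Finset.eq_singleton_iff_unique_mem.2 ⟨((I.enumBM_spec hT).2.1 _).1 (by rw [hx]; simp), fun y hy => ?_⟩
      have := ((I.enumBM_spec hT).2.1 y).2 hy
      rw [hx] at this
      simpa using this

/-- **THE FLAG OF A LIVE LINE'S LABEL IS ITS OWN RENEWAL STATUS** (labels are injective on live lines) [folklore] -/
theorem rnwM_lab_iff (hN : I.NewOK) {j : ℕ} {τ : Line d} (hτ : τ ∈ I.StM j) : I.rnwM j (lab τ) = true ↔ I.RnwM j τ := by
  simp only [rnwM, decide_eq_true_eq]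
  constructor
  · rintro ⟨τ', hτ', hl, hr⟩
    rwa [I.lab_injOn_StM hN j hτ' hτ hl] at hr
  · exact fun h => ⟨τ, hτ, rfl, h⟩

/-- an old vertex of a block at level `j + 1` is a live, alive line of level `j` [folklore] -/
theorem mem_StM_of_inl_mem_blockM {j : ℕ} {T : Finset (Line d ⊕ Lab d)} (hT : T ∈ I.blocksM (j + 1) (I.PrevM (j + 1)))
    {τ : Line d} (hτ : Sum.inl τ ∈ T) : τ ∈ I.StM j ∧ I.AliveM j τ := by
  have h := (I.inl_mem_vertM).1 (subset_of_mem_tcomps hT hτ)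
  exact ⟨h.1, h.2⟩

/-! ## §2 The invariant: the construction's (t, E) is the extraction's; live lines are unready since their last event -/

/-- the event case at level `ℓ`: if the block is NOT a lone unrenewed old line, the extracted genealogy has its last
event AT `ℓ` and its last-event domain is the component's domain [folklore] -/
theorem event_caseM (hN : I.NewOK) {ℓ : ℕ} {T : Finset (Line d ⊕ Lab d)} (hT : T ∈ I.blocksM ℓ (I.PrevM ℓ))
    (hnone : I.loneOldM ℓ T = none) :
    (I.histM.pgenR I.rnwM ℓ (lab (I.newLineM ℓ T))).lastStep = ℓ ∧
      GeomHistoryR.edomR I.histM I.rnwM RunInput.domL ℓ (lab (I.newLineM ℓ T)) = fam (I.P ℓ) T := by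
  set c := lab (I.newLineM ℓ T) with hc
  have hc2 : RunInput.domL ℓ c = fam (I.P ℓ) T := by simp [RunInput.domL, hc, lab_newLineM]
  -- the block is: a single renewed old line, a single new region, or has two distinct vertices
  obtain ⟨v, hv⟩ := nonempty_of_mem_tcomps hT
  by_cases hsing : ∀ w ∈ T, w = v
  · have hTv : T = {v} := Finset.eq_singleton_iff_unique_mem.2 ⟨hv, hsing⟩
    cases v with
    | inl τ =>
        -- a single OLD line: it must be renewed (else `loneOldM` would be `some`)
        have hR : I.RnwM (ℓ - 1) τ := by
          by_contra hnr
          rw [hTv, I.loneOldM_singleton hnr] at hnone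
          exact Option.some_ne_none _ hnone
        cases ℓ with
        | zero => exact absurd (subset_of_mem_tcomps hT hv) (I.not_inl_mem_vertM_zero τ)
        | succ j =>
            have hτ := (I.mem_StM_of_inl_mem_blockM hT (hTv ▸ Finset.mem_singleton_self _)).1
            have hcs := I.constitM_block_inl hN hT hTv
            have hflag : I.rnwM j (lab τ) = true := (I.rnwM_lab_iff hN hτ).2 hR
            refine ⟨by rw [hc, I.histM.pgenR_succ_renew I.rnwM j _ _ hcs hflag]; rfl, ?_⟩
            rw [← hc2, hc]
            exact GeomHistoryR.edomR_succ_event I.histM I.rnwM RunInput.domL (by rw [hcs]; simp [lonePartR, hflag])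
    | inr n =>
        have hcs := I.constitM_block_inr hN hT hTv
        cases ℓ with
        | zero =>
            refine ⟨by rw [hc, I.histM.pgenR_zero_birth I.rnwM _ _ hcs]; rfl, ?_⟩
            rw [← hc2, hc]; rfl
        | succ j =>
            refine ⟨by rw [hc, I.histM.pgenR_succ_birth I.rnwM j _ _ hcs]; rfl, ?_⟩
            rw [← hc2, hc]
            exact GeomHistoryR.edomR_succ_event I.histM I.rnwM RunInput.domL (by rw [hcs]; simp [lonePartR])
  · -- two distinct vertices: a join chain at `ℓ`
    obtain ⟨w, hw'⟩ := not_forall.1 hsing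
    obtain ⟨hw, hwv⟩ := Classical.not_imp.1 hw'
    have h2 : 2 ≤ (I.histM.constit ℓ c).length := I.two_le_length_constitM hN hT hw hv hwv
    cases ℓ with
    | zero =>
        refine ⟨?_, by rw [← hc2, hc]; rfl⟩
        rw [I.histM.pgenR_zero_eq I.rnwM]
        refine lastStep_assembleR_of_two_le _ _ ?_
        have hl0 : (I.histM.parts 0 c).length = 0 := by rw [(I.wf_histM hN).parts_zero c]; rfl
        have hsum := length_lefts_add_length_rights (I.histM.constit 0 c)
        rw [ComponentHistory.length_births]
        simp only [ComponentHistory.parts] at hl0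
        simp only [ComponentHistory.news]
        omega
    | succ j =>
        refine ⟨?_, ?_⟩
        · rw [I.histM.pgenR_succ_eq I.rnwM]
          refine lastStep_assembleR_of_two_le _ _ ?_
          rw [ComponentHistory.length_constituentsR, ComponentHistory.parts, ComponentHistory.news,
            length_lefts_add_length_rights]
          exact h2
        · rw [← hc2, hc]
          exact GeomHistoryR.edomR_succ_event I.histM I.rnwM RunInput.domL (lonePartR_eq_none_of_two_le _ _ (hc ▸ h2))

/-- **THE INVARIANT, MEMORY-GENERIC.**  For every line live at level `ℓ`: `t ≤ ℓ`; `t` is the last step and `E` the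
last-event domain of the EXTRACTED genealogy of its label; and the line has not been ready — for the memory `Rm` — at
any scale strictly between its last event and `ℓ`. [folklore] -/
theorem invM (hN : I.NewOK) : ∀ (ℓ : ℕ), ∀ τ' ∈ I.StM ℓ,
    τ'.t ≤ ℓ ∧ τ'.t = (I.histM.pgenR I.rnwM ℓ (lab τ')).lastStep ∧
      τ'.E = GeomHistoryR.edomR I.histM I.rnwM RunInput.domL ℓ (lab τ') ∧
        ∀ k, k < ℓ - τ'.t → ¬ StopsM I.L I.s I.Rm τ'.t τ'.E k := by
  intro ℓ
  induction ℓ with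
  | zero =>
      intro τ' hτ'
      obtain ⟨T, hT, rfl⟩ := (I.mem_StM_iff).1 hτ'
      -- at level 0 every block is an event (no old lines)
      have hnone : I.loneOldM 0 T = none := by
        by_contra hs
        obtain ⟨τ, hs⟩ := Option.ne_none_iff_exists'.1 hs
        obtain ⟨hTe, -⟩ := I.eq_of_loneOldM_eq_some hs
        exact I.not_inl_mem_vertM_zero τ (subset_of_mem_tcomps hT (hTe ▸ Finset.mem_singleton_self _))
      obtain ⟨hlast, hedom⟩ := I.event_caseM hN hT hnone
      have hnl : I.newLineM 0 T = ⟨fam (I.P 0) T, 0, fam (I.P 0) T⟩ := by unfold newLineM; rw [hnone]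
      refine ⟨by rw [hnl], by rw [hlast, hnl], by rw [hedom, hnl], fun k hk => ?_⟩
      rw [hnl] at hk
      simp at hk
  | succ j ih =>
      intro τ' hτ'
      obtain ⟨T, hT, rfl⟩ := (I.mem_StM_iff).1 hτ'
      cases hlo : I.loneOldM (j + 1) T with
      | none =>
          obtain ⟨hlast, hedom⟩ := I.event_caseM hN hT hlo
          have hnl : I.newLineM (j + 1) T = ⟨fam (I.P (j + 1)) T, j + 1, fam (I.P (j + 1)) T⟩ := by
            unfold newLineM; rw [hlo]
          refine ⟨by rw [hnl], by rw [hlast, hnl], by rw [hedom, hnl], fun k hk => ?_⟩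
          rw [hnl] at hk
          simp at hk
      | some τ =>
          -- a lone UNRENEWED old line: no event, everything inherited
          obtain ⟨hTe, hnr⟩ := I.eq_of_loneOldM_eq_some hlo
          have hnl : I.newLineM (j + 1) T = ⟨fam (I.P (j + 1)) T, τ.t, τ.E⟩ := by unfold newLineM; rw [hlo]
          obtain ⟨hτ, halive⟩ := I.mem_StM_of_inl_mem_blockM hT (hTe ▸ Finset.mem_singleton_self _)
          obtain ⟨ht, hlast, hedom, hfirst⟩ := ih τ hτ
          have hcs := I.constitM_block_inl hN hT hTe
          have hflag : I.rnwM j (lab τ) = false := by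
            simpa using (show ¬ (I.rnwM j (lab τ) = true) from fun h => hnr ((I.rnwM_lab_iff hN hτ).1 h))
          have hpg : I.histM.pgenR I.rnwM (j + 1) (lab (I.newLineM (j + 1) T)) = I.histM.pgenR I.rnwM j (lab τ) :=
            I.histM.pgenR_succ_lone I.rnwM j _ _ hcs hflag
          have hed : GeomHistoryR.edomR I.histM I.rnwM RunInput.domL (j + 1) (lab (I.newLineM (j + 1) T)) =
              GeomHistoryR.edomR I.histM I.rnwM RunInput.domL j (lab τ) :=
            GeomHistoryR.edomR_succ_lone I.histM I.rnwM RunInput.domL hcs hflag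
          have hunready : ¬ StopsM I.L I.s I.Rm τ.t τ.E (j - τ.t) := I.not_rdyM_of_aliveM_not_rnwM halive hnr
          refine ⟨by rw [hnl]; exact ht.trans (Nat.le_succ j), by rw [hpg, hnl]; exact hlast,
            by rw [hed, hnl]; exact hedom, fun k hk => ?_⟩
          rw [hnl] at hk ⊢
          simp only at hk ⊢
          by_cases hkj : k < j - τ.t
          · exact hfirst k hkj
          · have : k = j - τ.t := by omega
            rw [this]; exact hunready

/-! ## §3 The memory-agnostic clauses hold for the memory-generic construction -/

/-- a frozen-memory stop is an `Rm`-memory stop when the memory is dominated (`stopsM_of_stops`, contraposed)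
[folklore] -/
theorem not_stops_of_not_stopsM (hRm : ∀ t k, I.Rm t k ≤ I.R t) {t₀ : ℕ} {Z : Finset (Pt d)} {k : ℕ}
    (h : ¬ StopsM I.L I.s I.Rm t₀ Z k) : ¬ Stops I.L I.s I.R t₀ Z k :=
  fun hs => h (stopsM_of_stops hRm hs)

/-- **THE DISPLAYED CLAUSES, MEMORY-AGNOSTIC FORM, HOLD FOR THE MEMORY-GENERIC CONSTRUCTION** under the input condition
`NewOK` and the DOMINATION `Rm t k ≤ R t` (print's current memory `R (t + k) ≤ R t` for non-increasing `R`, B15 p. 177;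
the frozen model with equality): (G-readyW) — a flagged part is `RdyM`-ready: `t < j` and condition (i) from the
`StopsM` stop, no frozen stop before by the invariant and domination; (G-pendR) — an unflagged old vertex is alive and
unrenewed ⇒ `RdyM`-unready at its level, unready before by the invariant, hence frozen-pending strictly before `j + 1`
by domination; the five geometric clauses as in row S15. [folklore] -/
theorem levelClausesW_histM (hN : I.NewOK) (hRm : ∀ t k, I.Rm t k ≤ I.R t) :
    GeomHistoryR.LevelClausesW I.histM I.rnwM RunInput.domL I.L I.s I.R where
  new_ok ℓ n hn := hN.ok ℓ n hn
  dom_birth ℓ c n hc hcs := by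
    obtain ⟨T, hT, rfl⟩ := I.mem_compM_iff.1 hc
    have hTe := I.blockM_of_constit_inr hN hT hcs
    simp [RunInput.domL, lab_newLineM, hTe, RunInput.P]
  dom_flow j c p hc hcs := by
    obtain ⟨T, hT, rfl⟩ := I.mem_compM_iff.1 hc
    obtain ⟨τ, hTe, hp⟩ := I.blockM_of_constit_inl hN hT hcs
    subst hp
    simp [RunInput.domL, hTe, RunInput.P, lab]
  ready j c hc p hp hflag := by
    obtain ⟨T, hT, rfl⟩ := I.mem_compM_iff.1 hc
    obtain ⟨τ, hτT, rfl⟩ := (I.mem_partsM_iff hN hT).1 hp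
    obtain ⟨hτ, -⟩ := I.mem_StM_of_inl_mem_blockM hT hτT
    obtain ⟨-, hlast, hedom, hfirst⟩ := I.invM hN j τ hτ
    have hR : I.RnwM j τ := (I.rnwM_lab_iff hN hτ).1 hflag
    have hstop : StopsM I.L I.s I.Rm τ.t τ.E (j - τ.t) := hR.1
    have hpos := hstop.pos
    rw [← hlast, ← hedom]
    exact ⟨by omega, hstop.condI, fun k hk => I.not_stops_of_not_stopsM hRm (hfirst k hk)⟩
  pend j c hc _ p hp hflag := by
    obtain ⟨T, hT, rfl⟩ := I.mem_compM_iff.1 hc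
    obtain ⟨τ, hτT, rfl⟩ := (I.mem_partsM_iff hN hT).1 hp
    obtain ⟨hτ, halive⟩ := I.mem_StM_of_inl_mem_blockM hT hτT
    obtain ⟨ht, hlast, hedom, hfirst⟩ := I.invM hN j τ hτ
    have hnr : ¬ I.RnwM j τ := fun h => by
      have := (I.rnwM_lab_iff hN hτ).2 h
      rw [hflag] at this
      exact Bool.false_ne_true this
    have hunready : ¬ StopsM I.L I.s I.Rm τ.t τ.E (j - τ.t) := I.not_rdyM_of_aliveM_not_rnwM halive hnr
    rw [← hlast, ← hedom]
    refine ⟨ht.trans (Nat.le_succ j), fun k hk => I.not_stops_of_not_stopsM hRm ?_⟩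
    by_cases hkj : k < j - τ.t
    · exact hfirst k hkj
    · have : k = j - τ.t := by omega
      rw [this]; exact hunready
  touch ℓ c hc _ := by
    obtain ⟨T, hT, rfl⟩ := I.mem_compM_iff.1 hc
    rw [I.constit_lab_newLineM hN hT, List.map_map]
    have : imgC I.L I.s RunInput.domL ℓ ∘ toLab = I.P ℓ := funext fun x => (I.P_eq_imgC ℓ x).symm
    rw [this]
    exact (I.enumBM_spec hT).2.2
  dom_join ℓ c hc _ := by
    obtain ⟨T, hT, rfl⟩ := I.mem_compM_iff.1 hc
    rw [I.constit_lab_newLineM hN hT, List.map_map]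
    have : imgC I.L I.s RunInput.domL ℓ ∘ toLab = I.P ℓ := funext fun x => (I.P_eq_imgC ℓ x).symm
    rw [this]
    intro x hx
    simp only [RunInput.domL, lab_newLineM] at hx
    obtain ⟨v, hv, hxv⟩ := mem_fam.1 hx
    exact mem_unionL.2 ⟨I.P ℓ v, List.mem_map.2 ⟨v, ((I.enumBM_spec hT).2.1 v).2 hv, rfl⟩, hxv⟩

/-! ## §4 Every component's pedigree is weakly realised; current domains are orbits and pairwise disjoint -/

/-- **EVERY COMPONENT OF THE MEMORY-GENERIC CONSTRUCTION IS WEAKLY REALISED**: for every `c ∈ comp ℓ`,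
`RealisesW L s R (pgenR ℓ c) (edomR ℓ c)` and its current domain `c.2` is the orbit of the last-event domain from the
last step (under `NewOK` and the domination `Rm ≤ R` only) — IR-41-7 (i)'s `realisesW_pgenR` applied. [folklore] -/
theorem realisesW_histM (hN : I.NewOK) (hRm : ∀ t k, I.Rm t k ≤ I.R t) {ℓ : ℕ} {c : Lab d} (hc : c ∈ I.histM.comp ℓ) :
    RealisesW I.L I.s I.R (I.histM.pgenR I.rnwM ℓ c) (GeomHistoryR.edomR I.histM I.rnwM RunInput.domL ℓ c) ∧
      c.2 = orbit I.L I.s (I.histM.pgenR I.rnwM ℓ c).lastStep (GeomHistoryR.edomR I.histM I.rnwM RunInput.domL ℓ c)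
        (ℓ - (I.histM.pgenR I.rnwM ℓ c).lastStep) :=
  realisesW_pgenR (I.wf_histM hN) (I.levelClausesW_histM hN hRm) ℓ c hc

/-- **DISTINCT COMPONENTS OF ONE LEVEL HAVE DISJOINT CURRENT DOMAINS** (= orbits of their last-event domains).
[folklore] -/
theorem disjoint_orbits_histM (hN : I.NewOK) (hRm : ∀ t k, I.Rm t k ≤ I.R t) {K : ℕ} {c c' : Lab d}
    (hc : c ∈ I.histM.comp K) (hc' : c' ∈ I.histM.comp K) (hne : c ≠ c') :
    Disjoint (orbit I.L I.s (I.histM.pgenR I.rnwM K c).lastStep (GeomHistoryR.edomR I.histM I.rnwM RunInput.domL K c)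
        (K - (I.histM.pgenR I.rnwM K c).lastStep))
      (orbit I.L I.s (I.histM.pgenR I.rnwM K c').lastStep (GeomHistoryR.edomR I.histM I.rnwM RunInput.domL K c')
        (K - (I.histM.pgenR I.rnwM K c').lastStep)) := by
  refine disjoint_orbit_of_disjoint_domW (I.wf_histM hN) (I.levelClausesW_histM hN hRm) hc hc' ?_
  obtain ⟨τ, hτ, rfl⟩ := Finset.mem_image.1 hc
  obtain ⟨τ', hτ', rfl⟩ := Finset.mem_image.1 hc'
  have hne' : τ ≠ τ' := fun h => hne (by rw [h])
  simpa [RunInput.domL, lab] using (I.StM_nonempty_disjoint hN K).2 τ hτ τ' hτ' hne'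

/-- the pedigree of every component obeys print's timing discipline `Adm` at its level [folklore] -/
theorem adm_histM (hN : I.NewOK) (hRm : ∀ t k, I.Rm t k ≤ I.R t) {ℓ : ℕ} {c : Lab d} (hc : c ∈ I.histM.comp ℓ) :
    (I.histM.pgenR I.rnwM ℓ c).Adm ℓ :=
  adm_of_mem_compW (I.wf_histM hN) (I.levelClausesW_histM hN hRm) hc

end RunInputM

end

end Summit.QuantumFields.BalabanUV.T4Continuum.HistoryGenealogyInstantiate
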